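import Summits.ValiantsHypothesis.ValiantsHypothesis.Theorems.KPlusLogSqLawTridiagonalRealStaticDescartesRow

/-!
# Route «KPlusLogSqLaw», crux `WeakLifting` (stmt-ValiantsHypothesis-19561) — REAL side of the tridiagonal sector:
# the SLOPE-SUM ROW of the α register — `Z(D_m) ≤ #S_m − 1` for every slope-sum envelope `S` — and its corollaries:
# the LATTICE SPAN ROW `Z ≤ Σ_t |L_t| / L`, the EQUAL-SPEED LAW `Z ≤ m − 1`, and the TWO-SPEED LAW `Z ≤ (2⌊m/2⌋+1)² − 1` (all sizes)

HONEST FRAMING.  Helper (`--supports stmt-ValiantsHypothesis-19561 --as helper`), seat val-sym-lift-p2 (g16), cell `pub-symmetroid`,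
2026-08-28; α register (static symmetric tridiagonal row `B m`), UPPER side.  The desk's α target (a LINEAR all-designs law
`Z ≤ C·m + C₀`) is NOT proved here and α stays NO MOVER.  What this file adds to the register's table is the honest DESCARTES COUNT IN
SLOPE CURRENCY and three thin-sector all-sizes laws that follow from it.  In the continuant currency `D_k = pathDet a d b f k`
(`D₀ = 1`, `D₁ = a₀X^{d₀}`, `D_{t+2} = a_{t+1}X^{d_{t+1}}D_{t+1} − (b_tX^{f_t})²D_t`) write `L_t := 2 f_t − d_t − d_{t+1} ∈ ℤ` for the
EDGE SLOPE of the link `t — t+1` (the exponent of the normalised link weight `b_t²X^{2f_t}/(a_tX^{d_t}·a_{t+1}X^{d_{t+1}})`, the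
gauge-invariant datum of the design; lift-p3 g13's «edge normal form»).  Expanding the continuant over the matchings `M` of the path,
every monomial of `D_m` has exponent `Σ_{j<m} d_j + Σ_{t∈M} L_t`; so the support of `D_m` is governed by the SLOPE-SUM SETS.

* `support_pathDet_subset_slopeSum` — for every SLOPE-SUM ENVELOPE `S : ℕ → Finset ℤ` (`0 ∈ S 0`, `0 ∈ S 1`, `S (k+1) ⊆ S (k+2)` and
  `S k + L_k ⊆ S (k+2)` for `k + 2 ≤ m`): `supp(D_m) ⊆ Σ_{j<m} d_j + S m`; `card_support_pathDet_le_card` — `#supp(D_m) ≤ #(S m)`.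
* **`card_posRoots_pathDet_le_slopeSum` (SLOPE-SUM ROW, all sizes, no positivity / irreducibility needed)**: the distinct positive zeros of
  `D_m` number at most `#(S m) − 1` (with multiplicity: `countP_roots_pos_pathDet_le_slopeSum`) — Descartes' rule after collecting
  coincident exponents.  The smallest envelope is the set of matching slope-sums `{Σ_{t∈M} L_t}`, of size `≤ F_{m+1}` (the Fibonacci row
  `…DescartesRow.card_posRoots_pathDet_le_fib` is the case of pairwise distinct sums), and for a typed design it is a `decide`-able finite set:
  e.g. the tree's `4 × 4` three-zero witness (links `2X, 3X³, 2X`, constant diagonal; slopes `(2, 6, 2)`) has slope-sums `{0, 2, 4, 6}`, so the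
  row gives `Z ≤ 3` — sharp — where the Fibonacci row gives `4` (`card_posRoots_pathDet_le_three_of_slopes_two_six_two`).
* **`card_posRoots_pathDet_le_latticeSpan` (LATTICE SPAN ROW)**: if `L_t = L·μ_t` (`t < m − 1`) for an integer `L` and integers `μ_t`, then
  `Z(D_m) ≤ Σ_{t<m−1} |μ_t|`; in particular (`L = 1`) **`card_posRoots_pathDet_le_span`: `Z(D_m) ≤ Σ_{t<m−1} |2f_t − d_t − d_{t+1}|`**.
* **`card_posRoots_pathDet_le_of_equalSpeed` (EQUAL-SPEED LAW, all sizes)**: if all edge slopes have the same modulus, `L_t ∈ {L, −L}` for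
  `t < m − 1`, then `Z(D_m) ≤ m − 1`.  (`m − 1` is the register's exact value for `m ≤ 4`: `B 3 = 2`, `B 4 = 3`; from `m = 5` on the located
  values `7, 9, 11, 12, 13` exceed it, so the excess of the register over `m − 1` is carried by SPEED DISPERSION — the `B 5 = 7` design has
  rates `(−1805, 1880, 6277, 4398)`.)
* **`card_posRoots_pathDet_le_of_twoSpeeds` (TWO-SPEED LAW, all sizes)**: if `L_t ∈ {α, −α, β, −β}` for `t < m − 1`, then
  `Z(D_m) ≤ (2⌊m/2⌋ + 1)² − 1` — quadratic in `m`; `r` speed classes give a polynomial of degree `r` by the same envelope (not typed).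
* Matrix currency of the α target (`c`, `e` symmetric, `c = 0` off the band; via lift-p3 g10's `det_of_eq_pathDet`):
  `card_posRoots_det_le_span`, `card_posRoots_det_le_of_equalSpeed`.

CAVEAT (honest).  These are SUPPORT laws: they see exponents, never magnitudes.  In the natural-exponent currency slopes are integers, so
the span row is a genuine all-designs bound, but it is an artefact of commensurability (it scales with the height of the slope vector:
vacuous for the register's extremal designs, whose rates have height `10³…10⁴`), and full Descartes alternation `F_{m+1} − 1` of the
matching sum IS realised by rate vectors (lift-p2 g14 `vmax.py`, re-checked by this seat for `n ≤ 8` edges) — a uniform law needs magnitudes.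
Nothing here bears on `WeakLifting` / `TropicalB` (stmt-19771) in their windows, on Conjecture B, on the Door-A registers, on
`MatrixDescartes` (stmt-ValiantsHypothesis-18050) or on VP ≠ VNP.
[folklore: continuants ↔ matchings of the path; Descartes' rule of signs; the slope bookkeeping is this seat's]
-/

set_option linter.dupNamespace false
set_option autoImplicit false

namespace Summit.ValiantsHypothesis.ValiantsHypothesis.Theorems.KPlusLogSqLaw

namespace SlopeSumRow

open Polynomial Finset
open Summit.ValiantsHypothesis.ValiantsHypothesis.Theorems.KPlusLogSqLaw.StaticTridiagonalRealPotential
  (pathDet pathDet_zero pathDet_one pathDet_add_two countP_roots_pos_le_of_card_support_le det_of_eq_pathDet)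
open Summit.ValiantsHypothesis.ValiantsHypothesis.Theorems.LacunarySymmetroidMatrixDescartes.Census (card_posRoots_le_countP_posRoots)

variable (a : ℕ → ℝ) (d : ℕ → ℕ) (b : ℕ → ℝ) (f : ℕ → ℕ)

/-! ## 1. Support bookkeeping -/

/-- Support of `C r · X^n · P` sits inside `n + supp P`. [bookkeeping] -/
theorem mem_support_C_mul_X_pow_mul {r : ℝ} {n i : ℕ} {P : ℝ[X]} (h : i ∈ (C r * X ^ n * P).support) :
    n ≤ i ∧ i - n ∈ P.support := by
  rw [mem_support_iff, mul_assoc, coeff_C_mul, coeff_X_pow_mul'] at h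
  by_cases hn : n ≤ i
  · rw [if_pos hn] at h
    exact ⟨hn, mem_support_iff.mpr (right_ne_zero_of_mul h)⟩
  · rw [if_neg hn, mul_zero] at h
    exact absurd rfl h

/-- **Support of the continuant sits in the slope-sum envelope.**  For every `S : ℕ → Finset ℤ` with `0 ∈ S 0`, `0 ∈ S 1`,
`S (k+1) ⊆ S (k+2)` and `s + L_k ∈ S (k+2)` for `s ∈ S k` (`k + 2 ≤ m`, `L_k = 2f_k − d_k − d_{k+1}`):
every exponent `i` of `D_k` (`k ≤ m`) satisfies `i − Σ_{j<k} d_j ∈ S k`. [this file] -/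
theorem support_pathDet_subset_slopeSum (S : ℕ → Finset ℤ) (m : ℕ) (h0 : (0 : ℤ) ∈ S 0) (h1 : (0 : ℤ) ∈ S 1)
    (hmono : ∀ k, k + 2 ≤ m → S (k + 1) ⊆ S (k + 2))
    (hstep : ∀ k, k + 2 ≤ m → ∀ s ∈ S k, s + (2 * (f k : ℤ) - d k - d (k + 1)) ∈ S (k + 2)) :
    ∀ k, k ≤ m → ∀ i ∈ (pathDet a d b f k).support, (i : ℤ) - ∑ j ∈ range k, (d j : ℤ) ∈ S k := by
  intro k
  induction k using Nat.strong_induction_on with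
  | _ k ih =>
    intro hk i hi
    rcases k with _ | _ | k
    · rw [pathDet_zero] at hi
      have : i = 0 := by
        have := Polynomial.support_C_mul_X_pow_subset 0 (1 : ℝ)
        rw [map_one, one_mul, pow_zero] at this
        simpa using this hi
      subst this
      simpa using h0
    · rw [pathDet_one] at hi
      have : i = d 0 := by simpa using Polynomial.support_C_mul_X_pow_subset (d 0) (a 0) hi
      subst this
      simpa using h1
    · rw [pathDet_add_two, sub_eq_add_neg,
        show (C (b k) * (X : ℝ[X]) ^ f k) ^ 2 = C (b k ^ 2) * X ^ (2 * f k) by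
          rw [mul_pow, ← map_pow, ← pow_mul, mul_comm (f k)], ← neg_mul, ← neg_mul, ← map_neg] at hi
      rcases Finset.mem_union.mp (Polynomial.support_add hi) with hA | hB
      · -- the term `a_{k+1} X^{d_{k+1}} · D_{k+1}`
        obtain ⟨hle, hmem⟩ := mem_support_C_mul_X_pow_mul hA
        have hrec := ih (k + 1) (by omega) (by omega) (i - d (k + 1)) hmem
        have e : ((i - d (k + 1) : ℕ) : ℤ) - ∑ j ∈ range (k + 1), (d j : ℤ) = (i : ℤ) - ∑ j ∈ range (k + 2), (d j : ℤ) := by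
          rw [Finset.sum_range_succ _ (k + 1), Nat.cast_sub hle]; ring
        rw [e] at hrec
        exact hmono k hk hrec
      · -- the term `−b_k² X^{2f_k} · D_k`
        obtain ⟨hle, hmem⟩ := mem_support_C_mul_X_pow_mul hB
        have hrec := ih k (by omega) (by omega) (i - 2 * f k) hmem
        have hs := hstep k hk _ hrec
        have e : ((i - 2 * f k : ℕ) : ℤ) - ∑ j ∈ range k, (d j : ℤ) + (2 * (f k : ℤ) - d k - d (k + 1)) =
            (i : ℤ) - ∑ j ∈ range (k + 2), (d j : ℤ) := by
          rw [Finset.sum_range_succ _ (k + 1), Finset.sum_range_succ _ k, Nat.cast_sub hle]; push_cast; ring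
        rw [e] at hs
        exact hs

/-- **`#supp(D_m) ≤ #(S m)`** for every slope-sum envelope `S`. [this file] -/
theorem card_support_pathDet_le_card (S : ℕ → Finset ℤ) (m : ℕ) (h0 : (0 : ℤ) ∈ S 0) (h1 : (0 : ℤ) ∈ S 1)
    (hmono : ∀ k, k + 2 ≤ m → S (k + 1) ⊆ S (k + 2))
    (hstep : ∀ k, k + 2 ≤ m → ∀ s ∈ S k, s + (2 * (f k : ℤ) - d k - d (k + 1)) ∈ S (k + 2)) :
    (pathDet a d b f m).support.card ≤ (S m).card := by
  refine Finset.card_le_card_of_injOn (fun i : ℕ => (i : ℤ) - ∑ j ∈ range m, (d j : ℤ)) ?_ ?_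
  · intro i hi
    exact support_pathDet_subset_slopeSum a d b f S m h0 h1 hmono hstep m le_rfl i (Finset.mem_coe.mp hi)
  · intro i _ i' _ h
    have : (i : ℤ) = i' := by simpa using h
    exact_mod_cast this

/-! ## 2. The slope-sum row -/

/-- **SLOPE-SUM ROW, with multiplicity (all sizes)**: for every slope-sum envelope `S`, the positive roots of `D_m` counted with
multiplicity number at most `#(S m) − 1`. [Descartes' rule of signs after collecting coincident exponents; this file] -/
theorem countP_roots_pos_pathDet_le_slopeSum (S : ℕ → Finset ℤ) (m : ℕ) (h0 : (0 : ℤ) ∈ S 0) (h1 : (0 : ℤ) ∈ S 1)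
    (hmono : ∀ k, k + 2 ≤ m → S (k + 1) ⊆ S (k + 2))
    (hstep : ∀ k, k + 2 ≤ m → ∀ s ∈ S k, s + (2 * (f k : ℤ) - d k - d (k + 1)) ∈ S (k + 2)) :
    (pathDet a d b f m).roots.countP (fun x => 0 < x) ≤ (S m).card - 1 := by
  have hc := card_support_pathDet_le_card a d b f S m h0 h1 hmono hstep
  rcases Nat.eq_zero_or_pos (S m).card with hz | hpos
  · rw [hz, Nat.le_zero, Finset.card_eq_zero, Polynomial.support_eq_empty] at hc
    rw [hc, Polynomial.roots_zero]
    simp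
  · exact countP_roots_pos_le_of_card_support_le (by rw [Nat.sub_add_cancel hpos]; exact hc)

/-- **SLOPE-SUM ROW (all sizes)**: for every slope-sum envelope `S` of the design (`0 ∈ S 0`, `0 ∈ S 1`, `S (k+1) ⊆ S (k+2)`,
`S k + (2f_k − d_k − d_{k+1}) ⊆ S (k+2)` for `k + 2 ≤ m`), the static symmetric tridiagonal design has at most `#(S m) − 1` distinct
positive determinant zeros.  No positivity of the diagonal and no irreducibility is needed. [this file] -/
theorem card_posRoots_pathDet_le_slopeSum (S : ℕ → Finset ℤ) (m : ℕ) (h0 : (0 : ℤ) ∈ S 0) (h1 : (0 : ℤ) ∈ S 1)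
    (hmono : ∀ k, k + 2 ≤ m → S (k + 1) ⊆ S (k + 2))
    (hstep : ∀ k, k + 2 ≤ m → ∀ s ∈ S k, s + (2 * (f k : ℤ) - d k - d (k + 1)) ∈ S (k + 2)) :
    ((pathDet a d b f m).roots.toFinset.filter (fun x => 0 < x)).card ≤ (S m).card - 1 :=
  (card_posRoots_le_countP_posRoots _).trans (countP_roots_pos_pathDet_le_slopeSum a d b f S m h0 h1 hmono hstep)

/-! ## 3. The lattice span row and the span row -/

/-- **LATTICE SPAN ROW (all sizes)**: if every edge slope is a multiple of one integer, `2f_t − d_t − d_{t+1} = L·μ_t` for `t + 2 ≤ m`,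
then `Z(D_m) ≤ Σ_{t<m−1} |μ_t|`.  (Envelope: `S k = L·[−Σ_{t<k−1} μ_t⁻, Σ_{t<k−1} μ_t⁺]`.) [this file] -/
theorem card_posRoots_pathDet_le_latticeSpan (m : ℕ) (L : ℤ) (μ : ℕ → ℤ)
    (hμ : ∀ t, t + 2 ≤ m → 2 * (f t : ℤ) - d t - d (t + 1) = L * μ t) :
    (((pathDet a d b f m).roots.toFinset.filter (fun x => 0 < x)).card : ℤ) ≤ ∑ t ∈ range (m - 1), |μ t| := by
  classical
  -- envelope: multiples of `L` with coefficient in `[−N_k, P_k]`, `N_k = Σ_{t<k−1} μ_t⁻`, `P_k = Σ_{t<k−1} μ_t⁺`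
  set N : ℕ → ℤ := fun k => ∑ t ∈ range (k - 1), max (-μ t) 0 with hN
  set P : ℕ → ℤ := fun k => ∑ t ∈ range (k - 1), max (μ t) 0 with hP
  set S : ℕ → Finset ℤ := fun k => (Finset.Icc (-N k) (P k)).image (fun i => L * i) with hS
  have hN0 : ∀ k, 0 ≤ N k := fun k => Finset.sum_nonneg fun t _ => le_max_right _ _
  have hP0 : ∀ k, 0 ≤ P k := fun k => Finset.sum_nonneg fun t _ => le_max_right _ _
  have hzero : ∀ k, (0 : ℤ) ∈ S k := fun k =>
    Finset.mem_image.mpr ⟨0, Finset.mem_Icc.mpr ⟨by linarith [hN0 k], hP0 k⟩, by ring⟩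
  have hNsucc : ∀ k, N (k + 2) = N (k + 1) + max (-μ k) 0 := by
    intro k; simp only [hN, show k + 2 - 1 = k + 1 from rfl, Nat.add_sub_cancel, Finset.sum_range_succ]
  have hPsucc : ∀ k, P (k + 2) = P (k + 1) + max (μ k) 0 := by
    intro k; simp only [hP, show k + 2 - 1 = k + 1 from rfl, Nat.add_sub_cancel, Finset.sum_range_succ]
  have hmono : ∀ k, k + 2 ≤ m → S (k + 1) ⊆ S (k + 2) := by
    intro k _ s hs
    obtain ⟨i, hi, rfl⟩ := Finset.mem_image.mp hs
    obtain ⟨hi1, hi2⟩ := Finset.mem_Icc.mp hi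
    refine Finset.mem_image.mpr ⟨i, Finset.mem_Icc.mpr ⟨?_, ?_⟩, rfl⟩
    · rw [hNsucc]; linarith [le_max_right (-μ k) 0]
    · rw [hPsucc]; linarith [le_max_right (μ k) 0]
  have hstep : ∀ k, k + 2 ≤ m → ∀ s ∈ S k, s + (2 * (f k : ℤ) - d k - d (k + 1)) ∈ S (k + 2) := by
    intro k hk s hs
    obtain ⟨i, hi, rfl⟩ := Finset.mem_image.mp hs
    obtain ⟨hi1, hi2⟩ := Finset.mem_Icc.mp hi
    rw [hμ k hk]
    refine Finset.mem_image.mpr ⟨i + μ k, Finset.mem_Icc.mpr ⟨?_, ?_⟩, by ring⟩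
    · -- `N k ≤ N (k+1)` and `N (k+2) = N (k+1) + max (−μ k) 0`
      have hNk : N k ≤ N (k + 1) := by
        simp only [hN, Nat.add_sub_cancel]
        exact Finset.sum_le_sum_of_subset_of_nonneg (Finset.range_mono (Nat.sub_le k 1)) fun t _ _ => le_max_right _ _
      rw [hNsucc]; linarith [le_max_left (-μ k) 0]
    · have hPk : P k ≤ P (k + 1) := by
        simp only [hP, Nat.add_sub_cancel]
        exact Finset.sum_le_sum_of_subset_of_nonneg (Finset.range_mono (Nat.sub_le k 1)) fun t _ _ => le_max_right _ _
      rw [hPsucc]; linarith [le_max_left (μ k) 0]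
  have hrow := card_posRoots_pathDet_le_slopeSum a d b f S m (hzero 0) (hzero 1) hmono hstep
  -- `#(S m) ≤ #Icc = P m + N m + 1`, and `P m + N m = Σ |μ t|`
  have hcard : (S m).card ≤ (Finset.Icc (-N m) (P m)).card := Finset.card_image_le
  rw [Int.card_Icc] at hcard
  have hsum : P m + N m = ∑ t ∈ range (m - 1), |μ t| := by
    simp only [hP, hN, ← Finset.sum_add_distrib]
    refine Finset.sum_congr rfl fun t _ => ?_
    rcases le_total 0 (μ t) with h | h
    · rw [max_eq_left h, max_eq_right (by linarith), abs_of_nonneg h]; ring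
    · rw [max_eq_right h, max_eq_left (by linarith), abs_of_nonpos h]; ring
  have htoNat : ((P m + 1 - -N m).toNat : ℤ) = P m + N m + 1 := by
    rw [Int.toNat_of_nonneg (by linarith [hN0 m, hP0 m])]; ring
  have h1 : (((pathDet a d b f m).roots.toFinset.filter (fun x => 0 < x)).card : ℤ) ≤ ((S m).card : ℤ) - 1 := by
    have hSpos : 1 ≤ (S m).card := Finset.card_pos.mpr ⟨0, hzero m⟩
    have := hrow
    omega
  calc (((pathDet a d b f m).roots.toFinset.filter (fun x => 0 < x)).card : ℤ)
      ≤ ((S m).card : ℤ) - 1 := h1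
    _ ≤ ((P m + 1 - -N m).toNat : ℤ) - 1 := by linarith [Int.ofNat_le.mpr hcard]
    _ = ∑ t ∈ range (m - 1), |μ t| := by rw [htoNat, hsum]; ring

/-- **SPAN ROW (all sizes)**: `Z(D_m) ≤ Σ_{t<m−1} |2f_t − d_t − d_{t+1}|` — the register's row is bounded by the height of the edge-slope
vector (a genuine all-designs bound in the natural-exponent currency, but one that scales with the exponents). [this file] -/
theorem card_posRoots_pathDet_le_span (m : ℕ) :
    (((pathDet a d b f m).roots.toFinset.filter (fun x => 0 < x)).card : ℤ) ≤
      ∑ t ∈ range (m - 1), |2 * (f t : ℤ) - d t - d (t + 1)| :=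
  card_posRoots_pathDet_le_latticeSpan a d b f m 1 (fun t => 2 * (f t : ℤ) - d t - d (t + 1)) (fun t _ => by ring)

/-! ## 4. The equal-speed law -/

/-- **EQUAL-SPEED LAW (all sizes)**: if all edge slopes have the same modulus — `2f_t − d_t − d_{t+1} ∈ {L, −L}` for `t + 2 ≤ m` — then the
static symmetric tridiagonal design has at most `m − 1` distinct positive determinant zeros (`= B 3, B 4`; the located register exceeds it
from `m = 5` on, so the excess is carried by speed dispersion). [this file] -/
theorem card_posRoots_pathDet_le_of_equalSpeed (m : ℕ) (L : ℤ)
    (hL : ∀ t, t + 2 ≤ m → 2 * (f t : ℤ) - d t - d (t + 1) = L ∨ 2 * (f t : ℤ) - d t - d (t + 1) = -L) :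
    ((pathDet a d b f m).roots.toFinset.filter (fun x => 0 < x)).card ≤ m - 1 := by
  classical
  set μ : ℕ → ℤ := fun t => if 2 * (f t : ℤ) - d t - d (t + 1) = L then 1 else -1 with hμ
  have hμL : ∀ t, t + 2 ≤ m → 2 * (f t : ℤ) - d t - d (t + 1) = L * μ t := by
    intro t ht
    rcases hL t ht with h | h
    · simp only [hμ, if_pos h, mul_one]; exact h
    · by_cases h' : 2 * (f t : ℤ) - d t - d (t + 1) = L
      · simp only [hμ, if_pos h', mul_one]; exact h'
      · simp only [hμ, if_neg h']; rw [h]; ring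
  have habs : ∀ t, |μ t| = 1 := by
    intro t; simp only [hμ]; split_ifs <;> simp
  have h := card_posRoots_pathDet_le_latticeSpan a d b f m L μ hμL
  simp only [habs, Finset.sum_const, Finset.card_range, nsmul_eq_mul, mul_one] at h
  omega

/-! ## 5. The two-speed law -/

/-- **TWO-SPEED LAW (all sizes)**: if every edge slope lies in `{α, −α, β, −β}` (`t + 2 ≤ m`), then the design has at most
`(2⌊m/2⌋ + 1)² − 1` distinct positive determinant zeros — quadratic in `m`.  (Envelope: `S k = {iα + jβ : |i|, |j| ≤ ⌊k/2⌋}`; with `r`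
speed classes the same envelope is a box of dimension `r`.) [this file] -/
theorem card_posRoots_pathDet_le_of_twoSpeeds (m : ℕ) (α β : ℤ)
    (hL : ∀ t, t + 2 ≤ m → 2 * (f t : ℤ) - d t - d (t + 1) = α ∨ 2 * (f t : ℤ) - d t - d (t + 1) = -α ∨
      2 * (f t : ℤ) - d t - d (t + 1) = β ∨ 2 * (f t : ℤ) - d t - d (t + 1) = -β) :
    ((pathDet a d b f m).roots.toFinset.filter (fun x => 0 < x)).card ≤ (2 * (m / 2) + 1) ^ 2 - 1 := by
  classical
  set S : ℕ → Finset ℤ := fun k =>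
    ((Finset.Icc (-(k / 2 : ℕ) : ℤ) (k / 2 : ℕ)) ×ˢ (Finset.Icc (-(k / 2 : ℕ) : ℤ) (k / 2 : ℕ))).image
      (fun p => p.1 * α + p.2 * β) with hS
  have hzero : ∀ k, (0 : ℤ) ∈ S k := fun k =>
    Finset.mem_image.mpr ⟨(0, 0), Finset.mem_product.mpr ⟨Finset.mem_Icc.mpr ⟨by omega, by omega⟩,
      Finset.mem_Icc.mpr ⟨by omega, by omega⟩⟩, by ring⟩
  -- one step of the box: `|i| ≤ ⌊k/2⌋ ⇒ |i|, |i ± 1| ≤ ⌊(k+2)/2⌋`, and `⌊(k+1)/2⌋ ≤ ⌊(k+2)/2⌋`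
  have hbox : ∀ (k : ℕ) (i δ : ℤ), i ∈ Finset.Icc (-(k / 2 : ℕ) : ℤ) (k / 2 : ℕ) → -1 ≤ δ → δ ≤ 1 →
      i + δ ∈ Finset.Icc (-((k + 2) / 2 : ℕ) : ℤ) ((k + 2) / 2 : ℕ) := by
    intro k i δ hi hδ1 hδ2
    obtain ⟨h1, h2⟩ := Finset.mem_Icc.mp hi
    have e : (((k + 2) / 2 : ℕ) : ℤ) = ((k / 2 : ℕ) : ℤ) + 1 := by
      rw [show (k + 2) / 2 = k / 2 + 1 by omega]; push_cast; ring
    rw [Finset.mem_Icc, e]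
    constructor <;> linarith
  have hbox' : ∀ (k : ℕ) (i : ℤ), i ∈ Finset.Icc (-((k + 1) / 2 : ℕ) : ℤ) ((k + 1) / 2 : ℕ) →
      i ∈ Finset.Icc (-((k + 2) / 2 : ℕ) : ℤ) ((k + 2) / 2 : ℕ) := by
    intro k i hi
    obtain ⟨h1, h2⟩ := Finset.mem_Icc.mp hi
    have e : (((k + 1) / 2 : ℕ) : ℤ) ≤ (((k + 2) / 2 : ℕ) : ℤ) := by
      exact_mod_cast Nat.div_le_div_right (by omega)
    rw [Finset.mem_Icc]
    constructor <;> linarith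
  have hmono : ∀ k, k + 2 ≤ m → S (k + 1) ⊆ S (k + 2) := by
    intro k _ s hs
    obtain ⟨p, hp, rfl⟩ := Finset.mem_image.mp hs
    obtain ⟨hp1, hp2⟩ := Finset.mem_product.mp hp
    exact Finset.mem_image.mpr ⟨p, Finset.mem_product.mpr ⟨hbox' k p.1 hp1, hbox' k p.2 hp2⟩, rfl⟩
  have hstep : ∀ k, k + 2 ≤ m → ∀ s ∈ S k, s + (2 * (f k : ℤ) - d k - d (k + 1)) ∈ S (k + 2) := by
    intro k hk s hs
    obtain ⟨p, hp, rfl⟩ := Finset.mem_image.mp hs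
    obtain ⟨hp1, hp2⟩ := Finset.mem_product.mp hp
    have h10 := hbox k p.1 0 hp1 (by norm_num) (by norm_num)
    have h20 := hbox k p.2 0 hp2 (by norm_num) (by norm_num)
    rw [add_zero] at h10 h20
    rcases hL k hk with h | h | h | h <;> rw [h]
    · exact Finset.mem_image.mpr ⟨(p.1 + 1, p.2), Finset.mem_product.mpr
        ⟨hbox k p.1 1 hp1 (by norm_num) (by norm_num), h20⟩, by push_cast; ring⟩
    · exact Finset.mem_image.mpr ⟨(p.1 + (-1), p.2), Finset.mem_product.mpr
        ⟨hbox k p.1 (-1) hp1 (by norm_num) (by norm_num), h20⟩, by push_cast; ring⟩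
    · exact Finset.mem_image.mpr ⟨(p.1, p.2 + 1), Finset.mem_product.mpr
        ⟨h10, hbox k p.2 1 hp2 (by norm_num) (by norm_num)⟩, by push_cast; ring⟩
    · exact Finset.mem_image.mpr ⟨(p.1, p.2 + (-1)), Finset.mem_product.mpr
        ⟨h10, hbox k p.2 (-1) hp2 (by norm_num) (by norm_num)⟩, by push_cast; ring⟩
  have hrow := card_posRoots_pathDet_le_slopeSum a d b f S m (hzero 0) (hzero 1) hmono hstep
  have hcard : (S m).card ≤ (2 * (m / 2) + 1) ^ 2 := by
    refine Finset.card_image_le.trans ?_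
    rw [Finset.card_product, Int.card_Icc, sq]
    have e : ((m / 2 : ℕ) : ℤ) + 1 - -((m / 2 : ℕ) : ℤ) = ((2 * (m / 2) + 1 : ℕ) : ℤ) := by push_cast; ring
    rw [e, Int.toNat_natCast]
  omega

/-! ## 6. A sharp instance: the `4 × 4` three-zero slope vector `(2, 6, 2)` -/

/-- For constant diagonal exponents `d ≡ 0` and link exponents `f = (1, 3, 1, …)` (the slope vector `(2, 6, 2)` of the tree's `4 × 4`
three-zero witness, links `2X, 3X³, 2X`), the slope-sums are `{0, 2, 4, 6}`, so `Z(D_4) ≤ 3` for EVERY choice of coefficients — sharp (the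
witness has three zeros), where the Fibonacci row gives `F₅ − 1 = 4`. [this file] -/
theorem card_posRoots_pathDet_le_three_of_slopes_two_six_two
    (hd : ∀ t, t < 4 → d t = 0) (hf0 : f 0 = 1) (hf1 : f 1 = 3) (hf2 : f 2 = 1) :
    ((pathDet a d b f 4).roots.toFinset.filter (fun x => 0 < x)).card ≤ 3 := by
  classical
  have hd0 := hd 0 (by omega)
  have hd1 := hd 1 (by omega)
  have hd2 := hd 2 (by omega)
  have hd3 := hd 3 (by omega)
  refine (card_posRoots_pathDet_le_slopeSum a d b f
    (fun k => if k ≤ 1 then ({0} : Finset ℤ) else if k = 2 then {0, 2} else if k = 3 then {0, 2, 6} else {0, 2, 4, 6}) 4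
    (by decide) (by decide) ?_ ?_).trans (by decide)
  · intro k hk
    have hk' : k ≤ 2 := by omega
    interval_cases k <;> decide
  · intro k hk
    have hk' : k ≤ 2 := by omega
    interval_cases k <;> simp only [Nat.reduceAdd, zero_add, hf0, hf1, hf2, hd0, hd1, hd2, hd3, Nat.cast_zero, Nat.cast_ofNat,
      Nat.cast_one] <;> decide

/-! ## 7. Matrix currency of the α target -/

/-- **SPAN ROW in the matrix currency (all sizes)**: a static symmetric tridiagonal `m × m` monomial matrix `(c i j · X^(e i j))`
(`c`, `e` symmetric, `c = 0` off the band) has at most `Σ_{t+1<m} |2 e_{t,t+1} − e_{t,t} − e_{t+1,t+1}|` distinct positive determinant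
zeros. [this file] -/
theorem card_posRoots_det_le_span (m : ℕ) (c : Fin m → Fin m → ℝ) (e : Fin m → Fin m → ℕ)
    (hc : ∀ i j, c i j = c j i) (he : ∀ i j, e i j = e j i)
    (hband : ∀ i j : Fin m, (i : ℕ) + 1 < j ∨ (j : ℕ) + 1 < i → c i j = 0) :
    (((Matrix.det (Matrix.of fun i j => C (c i j) * (X : ℝ[X]) ^ e i j)).roots.toFinset.filter
      (fun t : ℝ => 0 < t)).card : ℤ) ≤
      ∑ t ∈ range (m - 1), |2 * ((if h : t + 1 < m then e ⟨t, by omega⟩ ⟨t + 1, h⟩ else 0 : ℕ) : ℤ)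
        - ((if h : t < m then e ⟨t, h⟩ ⟨t, h⟩ else 0 : ℕ) : ℤ) - ((if h : t + 1 < m then e ⟨t + 1, h⟩ ⟨t + 1, h⟩ else 0 : ℕ) : ℤ)| := by
  rw [det_of_eq_pathDet c e hc he hband]
  exact card_posRoots_pathDet_le_span _ _ _ _ m

/-- **EQUAL-SPEED LAW in the matrix currency (all sizes)**: if `2 e_{t,t+1} − e_{t,t} − e_{t+1,t+1} ∈ {L, −L}` for every `t + 1 < m`,
the matrix has at most `m − 1` distinct positive determinant zeros. [this file] -/
theorem card_posRoots_det_le_of_equalSpeed (m : ℕ) (c : Fin m → Fin m → ℝ) (e : Fin m → Fin m → ℕ)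
    (hc : ∀ i j, c i j = c j i) (he : ∀ i j, e i j = e j i)
    (hband : ∀ i j : Fin m, (i : ℕ) + 1 < j ∨ (j : ℕ) + 1 < i → c i j = 0) (L : ℤ)
    (hL : ∀ (t : ℕ) (ht : t + 1 < m),
      2 * (e ⟨t, by omega⟩ ⟨t + 1, ht⟩ : ℤ) - e ⟨t, by omega⟩ ⟨t, by omega⟩ - e ⟨t + 1, ht⟩ ⟨t + 1, ht⟩ = L ∨
      2 * (e ⟨t, by omega⟩ ⟨t + 1, ht⟩ : ℤ) - e ⟨t, by omega⟩ ⟨t, by omega⟩ - e ⟨t + 1, ht⟩ ⟨t + 1, ht⟩ = -L) :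
    ((Matrix.det (Matrix.of fun i j => C (c i j) * (X : ℝ[X]) ^ e i j)).roots.toFinset.filter
      (fun t : ℝ => 0 < t)).card ≤ m - 1 := by
  rw [det_of_eq_pathDet c e hc he hband]
  refine card_posRoots_pathDet_le_of_equalSpeed _ _ _ _ m L fun t ht => ?_
  have h1 : t + 1 < m := by omega
  have h0 : t < m := by omega
  simp only [dif_pos h1, dif_pos h0]
  exact hL t h1

end SlopeSumRow

end Summit.ValiantsHypothesis.ValiantsHypothesis.Theorems.KPlusLogSqLaw
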